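import Mathlib
import HarnessLib
import Literature.RingTheory.CohomologyAnnihilator.Completion
import Summits.ResolutionOfSingularities.ResolutionOfSingularities.Theorems.HomologicalConductorPersistenceFaithfullyFlatDescentCompletion
import Summits.ResolutionOfSingularities.ResolutionOfSingularities.Theorems.HomologicalConductorPersistenceCompletionAscentHolds

set_option linter.dupNamespace false

/-!
# The completion transfer `ca(R) = ca(R̂) ∩ R`, unconditional

`[OURS · L w44b / W4.4 «C-comp» · res-type-015 gen 15]` — helper for the surface rung
`PersistenceSurface` (stmt-ResolutionOfSingularities-19970) and the specimen computations of crux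
chain W4.4 (`NoZeno` / `NoZenoR`).  NOT a statement of the manuscript under adjudication in cell
res-hironaka.

`Literature/RingTheory/CohomologyAnnihilator/Completion.lean` proves the consequences of
[BahlekehHakimianSalarianTakahashi2015, Thm. 4.5] MODULO its two halves, taken there as the named
facts `caCompletion_comap_le` (4.5 (1)) and `le_caCompletion_comap` (4.5 (2)).  Both are now theorems
of the tree (`caCompletion_comap_le_holds`, p512917; `le_caCompletion_comap_holds`, p523162), so the
consequences hold unconditionally; this file records them with the hypotheses `h₁ h₂` discharged:

* `cohomologyAnnihilator_eq_comap_completion` — `ca(R) = ca(R̂) ∩ R` for `R` noetherian local of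
  dimension `d` with `R̂` an isolated singularity;
* `exists_pow_le_cohomologyAnnihilator_iff` — `ca(R)` is `𝔪`-primary-or-unit iff `ca(R̂)` is;
* `cohomologyAnnihilator_completion_eq_map` — `ca(R̂) = ca(R)R̂` when moreover `ca(R) ⊇ 𝔪ᴺ`;
* `cohomologyAnnihilator_completion_eq_map_of_essFiniteType`,
  `cohomologyAnnihilator_completion_eq_map_of_isIntegrallyClosed` — the forms consumed by the route
  (local rings essentially of finite type over a field; normal surface germs).

References: A. Bahlekeh, E. Hakimian, S. Salarian, R. Takahashi, arXiv:1504.06163, Thm. 4.5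
[`BahlekehHakimianSalarianTakahashi2015`].
-/

noncomputable section

open IsLocalRing Literature.RingTheory.CohomologyAnnihilator
open Summit.ResolutionOfSingularities.ResolutionOfSingularities.Theorems.HomologicalConductor.PersistenceFaithfullyFlatDescentCompletion
open Summit.ResolutionOfSingularities.ResolutionOfSingularities.Theorems.HomologicalConductor.CompletionAscentHolds

universe u

namespace Summit.ResolutionOfSingularities.ResolutionOfSingularities.Theorems.HomologicalConductor.CompletionTransfer

/-- **[BahlekehHakimianSalarianTakahashi2015, Theorem 4.5 (2)], «Hence `ca(R) = ca(R̂) ∩ R`»**,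
unconditionally: for a noetherian local ring `R` of Krull dimension `d` whose completion is an
isolated singularity, `ca(R)` is the contraction of `ca(R̂)`.
[cite: BahlekehHakimianSalarianTakahashi2015, Theorem 4.5 (2)] -/
theorem cohomologyAnnihilator_eq_comap_completion {R : Type u} [CommRing R] [IsNoetherianRing R]
    [IsLocalRing R] {d : ℕ} (hd : ringKrullDim R = d)
    (hiso : IsIsolatedSingularity (AdicCompletion (maximalIdeal R) R)) :
    cohomologyAnnihilator R =
      (cohomologyAnnihilator (AdicCompletion (maximalIdeal R) R)).comap
        (algebraMap R (AdicCompletion (maximalIdeal R) R)) :=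
  Literature.RingTheory.CohomologyAnnihilator.cohomologyAnnihilator_eq_comap_completion
    caCompletion_comap_le_holds le_caCompletion_comap_holds hd hiso

/-- **[BahlekehHakimianSalarianTakahashi2015, Theorem 4.5], «`ca(R)` is `𝔪`-primary iff `ca(R̂)` is
`𝔪̂`-primary»**, unconditionally (in the form `∃ N, 𝔪ᴺ ⊆ ca`).
[cite: BahlekehHakimianSalarianTakahashi2015, Theorem 4.5 (2)] -/
theorem exists_pow_le_cohomologyAnnihilator_iff {R : Type u} [CommRing R] [IsNoetherianRing R]
    [IsLocalRing R] {d : ℕ} (hd : ringKrullDim R = d)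
    (hiso : IsIsolatedSingularity (AdicCompletion (maximalIdeal R) R)) :
    (∃ N : ℕ, maximalIdeal R ^ N ≤ cohomologyAnnihilator R) ↔
      ∃ N : ℕ, maximalIdeal (AdicCompletion (maximalIdeal R) R) ^ N ≤
        cohomologyAnnihilator (AdicCompletion (maximalIdeal R) R) :=
  Literature.RingTheory.CohomologyAnnihilator.exists_pow_le_cohomologyAnnihilator_iff
    caCompletion_comap_le_holds le_caCompletion_comap_holds hd hiso

/-- **`ca(R̂) = ca(R)·R̂`** for a noetherian local ring `R` of dimension `d` with `R̂` an isolated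
singularity and `ca(R) ⊇ 𝔪ᴺ` — unconditionally.
[cite: BahlekehHakimianSalarianTakahashi2015, Theorem 4.5 (consequence)] -/
theorem cohomologyAnnihilator_completion_eq_map {R : Type u} [CommRing R] [IsNoetherianRing R]
    [IsLocalRing R] {d : ℕ} (hd : ringKrullDim R = d)
    (hiso : IsIsolatedSingularity (AdicCompletion (maximalIdeal R) R))
    (hprim : ∃ N : ℕ, maximalIdeal R ^ N ≤ cohomologyAnnihilator R) :
    cohomologyAnnihilator (AdicCompletion (maximalIdeal R) R) =
      (cohomologyAnnihilator R).map (algebraMap R (AdicCompletion (maximalIdeal R) R)) :=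
  Literature.RingTheory.CohomologyAnnihilator.cohomologyAnnihilator_completion_eq_map
    caCompletion_comap_le_holds le_caCompletion_comap_holds hd hiso hprim

/-- **C-comp transfer for local rings essentially of finite type over a field**, unconditionally:
if `R` is a local ring which is a localisation of a finitely generated algebra over a field, `R` is
an isolated singularity of dimension `d`, and `R̂` is an isolated singularity, then
`ca(R̂) = ca(R)·R̂` and `ca(R) = ca(R̂) ∩ R`.
[cite: BahlekehHakimianSalarianTakahashi2015, Theorem 4.5 (consequence)] -/
theorem cohomologyAnnihilator_completion_eq_map_of_essFiniteType {k : Type u} [Field k]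
    {A : Type u} [CommRing A] [Algebra k A] (hA : Algebra.FiniteType k A) {dA : ℕ}
    (hdA : ringKrullDim A = dA) (U : Submonoid A) {R : Type u} [CommRing R] [Algebra A R]
    (hU : IsLocalization U R) [IsNoetherianRing R] [IsLocalRing R] {d : ℕ} (hd : ringKrullDim R = d)
    (hR : IsIsolatedSingularity R)
    (hiso : IsIsolatedSingularity (AdicCompletion (maximalIdeal R) R)) :
    cohomologyAnnihilator (AdicCompletion (maximalIdeal R) R) =
        (cohomologyAnnihilator R).map (algebraMap R (AdicCompletion (maximalIdeal R) R)) ∧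
      cohomologyAnnihilator R =
        (cohomologyAnnihilator (AdicCompletion (maximalIdeal R) R)).comap
          (algebraMap R (AdicCompletion (maximalIdeal R) R)) :=
  Literature.RingTheory.CohomologyAnnihilator.cohomologyAnnihilator_completion_eq_map_of_essFiniteType
    caCompletion_comap_le_holds le_caCompletion_comap_holds hA hdA U hU hd hR hiso

/-- **C-comp transfer for the normal two-dimensional stages of the route**, unconditionally: for a
normal local domain `R` of Krull dimension `d ≤ 2`, essentially of finite type over a field, whose
completion is an isolated singularity, `ca(R̂) = ca(R)·R̂` and `ca(R) = ca(R̂) ∩ R`.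
[cite: BahlekehHakimianSalarianTakahashi2015, Theorem 4.5 (consequence)] -/
theorem cohomologyAnnihilator_completion_eq_map_of_isIntegrallyClosed {k : Type u} [Field k]
    {A : Type u} [CommRing A] [Algebra k A] (hA : Algebra.FiniteType k A) {dA : ℕ}
    (hdA : ringKrullDim A = dA) (U : Submonoid A) {R : Type u} [CommRing R] [IsDomain R]
    [Algebra A R] (hU : IsLocalization U R) [IsNoetherianRing R] [IsLocalRing R]
    [IsIntegrallyClosed R] {d : ℕ} (hd : ringKrullDim R = d) (hd2 : d ≤ 2)
    (hiso : IsIsolatedSingularity (AdicCompletion (maximalIdeal R) R)) :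
    cohomologyAnnihilator (AdicCompletion (maximalIdeal R) R) =
        (cohomologyAnnihilator R).map (algebraMap R (AdicCompletion (maximalIdeal R) R)) ∧
      cohomologyAnnihilator R =
        (cohomologyAnnihilator (AdicCompletion (maximalIdeal R) R)).comap
          (algebraMap R (AdicCompletion (maximalIdeal R) R)) :=
  Literature.RingTheory.CohomologyAnnihilator.cohomologyAnnihilator_completion_eq_map_of_isIntegrallyClosed
    caCompletion_comap_le_holds le_caCompletion_comap_holds hA hdA U hU hd hd2 hiso

end Summit.ResolutionOfSingularities.ResolutionOfSingularities.Theorems.HomologicalConductor.CompletionTransfer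

end
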